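import Summits.Ventures.Crystal3D.Theorems.StickyWulffConstantGenericWallFloorNearIdentityCore
import HarnessLib

/-!
# Double tops, local part 1: first-order forms of the cluster and cage constraints near a co-axial
# configuration, with exact quadratic remainders (crux `GenericWallFloor`, line `WallLedgerG`, residual `#DT₁₁`)

HONEST FRAMING. Part of the venture `Summits/Ventures/Crystal3D` (cell `crystal3d-full`), helper
`--supports` the crux `GenericWallFloor` (stmt-Ventures-19480) of `route-Ventures-StickyWulffConstant`,
registered line `WallLedgerG`, open stub `stub_twoSlabAdhesion`.  The chain ledger
(`twoSlabAdhesion_chainLedger'`, 19480-p2) carries the residual `#DT₁₁` = coincidence double tops of degree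
`11`; cf-p1 ROUTE §82(3)/(7) asks for the lemma «deg(double top) ≤ 10 unless the pair is co-axial»
(DoubleTopDegree / R39d «DoubleStarFree»).  Its LOCAL half — misorientations close to one of the finitely
many co-axial configurations at which a double top with an eleventh ball exists exactly (the straight
column and the Σ3 twin; margin → 0 there, so no interval certificate can see them) — is a first-order
rigidity statement; this file is its analytic core, in the cubic frame (`Fin 3 → ℝ`, module
`…NearIdentityCore`: `1 + κ` orthogonal, `a` = axis of the skew part of `κ`, `F = ‖κ‖_F²`).

Every constraint of the double-top configuration is a quadratic inequality whose linear part is a linear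
form in `(a, η)` (`η = y − y₀` the displacement of the eleventh ball from the free slot) and whose
remainder is bounded by an explicit multiple of `F` and `|η|²`:

* `axis_dot_cross_le_of_contact` — a CONTACT pair (own ball `P`, foreign ball `(1+κ)Q`, `|P − Q|` the
  contact distance): `|P − (1+κ)Q|² ≥ |P − Q|²` ⇒ `a ⬝ (Q × P) ≤ F (|P|² + |Q|²)/4`;
* `cage_fixed_le` — a fixed cage ball: `|y − P|² ≥ |y₀ − P|²` ⇒ `(P − y₀) ⬝ η ≤ |η|²/2`;
* `cage_moving_le` — a moving cage ball: `|y − (1+κ)Q|² ≥ |y₀ − Q|²` ⇒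
  `(Q − y₀) ⬝ η + a ⬝ (Q × y₀) ≤ |η|² + F (3|Q|² + |y₀|²)/4`;
* `dot_eq_of_sphere` — `|y| = |y₀|` ⇒ `y₀ ⬝ η = −|η|²/2`;
* `axis_dot_cross_eq_zero_of_fixed` — a COINCIDENT ball (`(1+κ)x = x`) ⇒ `a ⬝ (x × w) = 0` for all `w`;
* `ne_add_mulVec_of_lt` — a contact pair cannot become coincident while `F |Q|² < |P − Q|²`;
* `frob_le_axis_sq` — `F ≤ 1 ⇒ F ≤ (8/3)|a|²` (from `two_axis_sq_ge`); `eq_zero_of_le_mul_sq` — the final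
  squeeze `0 ≤ U ≤ K U², U < 1/K ⇒ U = 0`.

Part 2 (`…DoubleTopLocalCert`) turns a finite positive-spanning certificate over `ℚ` into
«`F + |η|² < 1/K ⇒ κ = 0`»; part 3 supplies the certificates for the critical configurations.

WHAT THIS IS NOT: no configuration data, no certificate, not the global (interval) half, not the stub;
rung F-C1 not moved.
-/

noncomputable section

namespace Summit.Ventures.Crystal3D.Theorems.NearIdentity

open Matrix

/-- The axis of the skew part of `κ`:  `skew(κ) y = a × y`. -/
def axisOf (κ : Matrix (Fin 3) (Fin 3) ℝ) : Fin 3 → ℝ :=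
  ![(κ 2 1 - κ 1 2) / 2, (κ 0 2 - κ 2 0) / 2, (κ 1 0 - κ 0 1) / 2]

/-- The squared Frobenius norm `‖κ‖_F²`. -/
def frob (κ : Matrix (Fin 3) (Fin 3) ℝ) : ℝ := ∑ i, ∑ j, κ i j ^ 2

/-- `‖κ‖_F² ≥ 0`. -/
theorem frob_nonneg (κ : Matrix (Fin 3) (Fin 3) ℝ) : 0 ≤ frob κ :=
  Finset.sum_nonneg fun _ _ => Finset.sum_nonneg fun _ _ => sq_nonneg _

/-- `|κ o|² ≤ F |o|²` (restated with `frob`). -/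
theorem mulVec_sq_le' (κ : Matrix (Fin 3) (Fin 3) ℝ) (o : Fin 3 → ℝ) :
    (κ *ᵥ o) ⬝ᵥ (κ *ᵥ o) ≤ frob κ * (o ⬝ᵥ o) := mulVec_sq_le κ o

/-- `(κ P) ⬝ (κ Q) ≤ F (|P|² + |Q|²)/2`. -/
theorem mulVec_dot_mulVec_le (κ : Matrix (Fin 3) (Fin 3) ℝ) (P Q : Fin 3 → ℝ) :
    (κ *ᵥ P) ⬝ᵥ (κ *ᵥ Q) ≤ frob κ * (P ⬝ᵥ P + Q ⬝ᵥ Q) / 2 := by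
  have hP := mulVec_sq_le' κ P
  have hQ := mulVec_sq_le' κ Q
  -- 2 u⬝v ≤ |u|² + |v|²
  have h2 : 2 * ((κ *ᵥ P) ⬝ᵥ (κ *ᵥ Q)) ≤ (κ *ᵥ P) ⬝ᵥ (κ *ᵥ P) + (κ *ᵥ Q) ⬝ᵥ (κ *ᵥ Q) := by
    have := (by rw [dot_self_eq_sum_sq]; exact Finset.sum_nonneg fun _ _ => sq_nonneg _ : (0:ℝ) ≤ (κ *ᵥ P - κ *ᵥ Q) ⬝ᵥ (κ *ᵥ P - κ *ᵥ Q))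
    simp only [dotProduct, Fin.sum_univ_three, Pi.sub_apply] at this ⊢
    nlinarith [this]
  linarith

/-- The first/second-order split of `…NearIdentityCore`, with the named axis. -/
theorem dot_mulVec_eq (κ : Matrix (Fin 3) (Fin 3) ℝ)
    (horth : ∀ i j, κ i j + κ j i + ∑ l, κ l i * κ l j = 0) (o w : Fin 3 → ℝ) :
    o ⬝ᵥ (κ *ᵥ w) = axisOf κ ⬝ᵥ crossProduct w o - (κ *ᵥ o) ⬝ᵥ (κ *ᵥ w) / 2 :=
  dot_mulVec_eq_axis_cross_sub κ horth o w

/-- `w ⬝ κ w = −|κ w|²/2`. -/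
theorem self_dot_mulVec_eq (κ : Matrix (Fin 3) (Fin 3) ℝ)
    (horth : ∀ i j, κ i j + κ j i + ∑ l, κ l i * κ l j = 0) (w : Fin 3 → ℝ) :
    w ⬝ᵥ (κ *ᵥ w) = -((κ *ᵥ w) ⬝ᵥ (κ *ᵥ w)) / 2 := by
  rw [dot_mulVec_eq κ horth w w]
  have : crossProduct w w = 0 := by
    ext i; fin_cases i <;> simp [crossProduct] <;> ring
  rw [this, dotProduct_zero]; ring

/-! ### The four constraint families -/

/-- **Contact pair.**  Own ball at `P`, foreign ball at `(1+κ)Q = Q + κQ`; if the pair does not get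
closer than it was (`|P − (Q + κQ)|² ≥ |P − Q|²`), then `a ⬝ (Q × P) ≤ F (|P|² + |Q|²)/4`. -/
theorem axis_dot_cross_le_of_contact (κ : Matrix (Fin 3) (Fin 3) ℝ)
    (horth : ∀ i j, κ i j + κ j i + ∑ l, κ l i * κ l j = 0) (P Q : Fin 3 → ℝ)
    (h : (P - Q) ⬝ᵥ (P - Q) ≤ (P - (Q + κ *ᵥ Q)) ⬝ᵥ (P - (Q + κ *ᵥ Q))) :
    axisOf κ ⬝ᵥ crossProduct Q P ≤ frob κ * (P ⬝ᵥ P + Q ⬝ᵥ Q) / 4 := by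
  have e1 : (P - (Q + κ *ᵥ Q)) ⬝ᵥ (P - (Q + κ *ᵥ Q)) =
      (P - Q) ⬝ᵥ (P - Q) - 2 * (P ⬝ᵥ (κ *ᵥ Q)) + 2 * (Q ⬝ᵥ (κ *ᵥ Q)) + (κ *ᵥ Q) ⬝ᵥ (κ *ᵥ Q) := by
    simp only [dotProduct, Fin.sum_univ_three, Pi.sub_apply, Pi.add_apply]; ring
  rw [dot_mulVec_eq κ horth P Q, self_dot_mulVec_eq κ horth Q] at e1
  have hb := mulVec_dot_mulVec_le κ P Q
  linarith

/-- **Fixed cage ball.**  `|y₀ + η − P|² ≥ |y₀ − P|²` ⇒ `(P − y₀) ⬝ η ≤ |η|²/2`. -/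
theorem cage_fixed_le (P y₀ η : Fin 3 → ℝ)
    (h : (y₀ - P) ⬝ᵥ (y₀ - P) ≤ (y₀ + η - P) ⬝ᵥ (y₀ + η - P)) :
    (P - y₀) ⬝ᵥ η ≤ η ⬝ᵥ η / 2 := by
  simp only [dotProduct, Fin.sum_univ_three, Pi.sub_apply, Pi.add_apply] at h ⊢
  nlinarith [h]

/-- **Moving cage ball.**  `|y₀ + η − (Q + κQ)|² ≥ |y₀ − Q|²` ⇒
`(Q − y₀) ⬝ η + a ⬝ (Q × y₀) ≤ |η|² + F (3|Q|² + |y₀|²)/4`. -/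
theorem cage_moving_le (κ : Matrix (Fin 3) (Fin 3) ℝ)
    (horth : ∀ i j, κ i j + κ j i + ∑ l, κ l i * κ l j = 0) (Q y₀ η : Fin 3 → ℝ)
    (h : (y₀ - Q) ⬝ᵥ (y₀ - Q) ≤ (y₀ + η - (Q + κ *ᵥ Q)) ⬝ᵥ (y₀ + η - (Q + κ *ᵥ Q))) :
    (Q - y₀) ⬝ᵥ η + axisOf κ ⬝ᵥ crossProduct Q y₀ ≤ η ⬝ᵥ η + frob κ * (3 * (Q ⬝ᵥ Q) + y₀ ⬝ᵥ y₀) / 4 := by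
  have e1 : (y₀ + η - (Q + κ *ᵥ Q)) ⬝ᵥ (y₀ + η - (Q + κ *ᵥ Q)) =
      (y₀ - Q) ⬝ᵥ (y₀ - Q) + 2 * ((y₀ - Q) ⬝ᵥ η) - 2 * (y₀ ⬝ᵥ (κ *ᵥ Q)) + 2 * (Q ⬝ᵥ (κ *ᵥ Q)) +
        (η - κ *ᵥ Q) ⬝ᵥ (η - κ *ᵥ Q) := by
    simp only [dotProduct, Fin.sum_univ_three, Pi.sub_apply, Pi.add_apply]; ring
  rw [dot_mulVec_eq κ horth y₀ Q, self_dot_mulVec_eq κ horth Q] at e1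
  have hb := mulVec_dot_mulVec_le κ y₀ Q
  have hQ := mulVec_sq_le' κ Q
  -- |η − κQ|² ≤ 2|η|² + 2|κQ|²
  have h2 : (η - κ *ᵥ Q) ⬝ᵥ (η - κ *ᵥ Q) ≤ 2 * (η ⬝ᵥ η) + 2 * ((κ *ᵥ Q) ⬝ᵥ (κ *ᵥ Q)) := by
    have := (by rw [dot_self_eq_sum_sq]; exact Finset.sum_nonneg fun _ _ => sq_nonneg _ : (0:ℝ) ≤ (η + κ *ᵥ Q) ⬝ᵥ (η + κ *ᵥ Q))
    simp only [dotProduct, Fin.sum_univ_three, Pi.sub_apply, Pi.add_apply] at this ⊢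
    nlinarith [this]
  have e2 : (Q - y₀) ⬝ᵥ η = -((y₀ - Q) ⬝ᵥ η) := by
    simp only [dotProduct, Fin.sum_univ_three, Pi.sub_apply]; ring
  rw [e2]
  nlinarith [h, hb, hQ, h2, frob_nonneg κ, (by rw [dot_self_eq_sum_sq]; exact Finset.sum_nonneg fun _ _ => sq_nonneg _ : (0:ℝ) ≤ Q ⬝ᵥ Q), (by rw [dot_self_eq_sum_sq]; exact Finset.sum_nonneg fun _ _ => sq_nonneg _ : (0:ℝ) ≤ y₀ ⬝ᵥ y₀)]

/-- **Sphere.**  `|y₀ + η|² = |y₀|²` ⇒ `y₀ ⬝ η = −|η|²/2`. -/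
theorem dot_eq_of_sphere (y₀ η : Fin 3 → ℝ) (h : (y₀ + η) ⬝ᵥ (y₀ + η) = y₀ ⬝ᵥ y₀) :
    y₀ ⬝ᵥ η = -(η ⬝ᵥ η) / 2 := by
  simp only [dotProduct, Fin.sum_univ_three, Pi.add_apply] at h ⊢
  linarith

/-- **Coincident ball.**  If `(1+κ) x = x` then the axis is parallel to `x`:  `a ⬝ (x × w) = 0`. -/
theorem axis_dot_cross_eq_zero_of_fixed (κ : Matrix (Fin 3) (Fin 3) ℝ)
    (horth : ∀ i j, κ i j + κ j i + ∑ l, κ l i * κ l j = 0) (x w : Fin 3 → ℝ) (hx : κ *ᵥ x = 0) :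
    axisOf κ ⬝ᵥ crossProduct x w = 0 := by
  have := dot_mulVec_eq κ horth w x
  rw [hx, dotProduct_zero, dotProduct_zero, zero_div, sub_zero] at this
  exact this.symm

/-- **A contact cannot close up completely:** if `F |Q|² < |P − Q|²` then `P ≠ Q + κQ`. -/
theorem ne_add_mulVec_of_lt (κ : Matrix (Fin 3) (Fin 3) ℝ) (P Q : Fin 3 → ℝ)
    (h : frob κ * (Q ⬝ᵥ Q) < (P - Q) ⬝ᵥ (P - Q)) : P ≠ Q + κ *ᵥ Q := by
  intro hP
  have : (P - Q) ⬝ᵥ (P - Q) = (κ *ᵥ Q) ⬝ᵥ (κ *ᵥ Q) := by rw [hP, add_sub_cancel_left]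
  linarith [mulVec_sq_le' κ Q]

/-! ### The squeeze -/

/-- `F ≤ 1 ⇒ F ≤ (8/3)|a|²`. -/
theorem frob_le_axis_sq (κ : Matrix (Fin 3) (Fin 3) ℝ)
    (horth : ∀ i j, κ i j + κ j i + ∑ l, κ l i * κ l j = 0) (h1 : frob κ ≤ 1) :
    frob κ ≤ 8 / 3 * (axisOf κ ⬝ᵥ axisOf κ) := by
  have h := two_axis_sq_ge κ horth
  change frob κ - frob κ ^ 2 / 4 ≤ 2 * (axisOf κ ⬝ᵥ axisOf κ) at h
  nlinarith [frob_nonneg κ]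

/-- `κ = 0` once `F = 0`. -/
theorem eq_zero_of_frob_eq_zero (κ : Matrix (Fin 3) (Fin 3) ℝ) (h : frob κ = 0) : κ = 0 := by
  have h' : ∀ i, ∑ j, κ i j ^ 2 = 0 := by
    have := (Finset.sum_eq_zero_iff_of_nonneg fun i _ => Finset.sum_nonneg fun j _ => sq_nonneg (κ i j)).1 h
    exact fun i => this i (Finset.mem_univ i)
  ext i j
  have := (Finset.sum_eq_zero_iff_of_nonneg fun j _ => sq_nonneg (κ i j)).1 (h' i) j (Finset.mem_univ j)
  simpa using this

/-- **The squeeze:** `0 ≤ U ≤ K·U²` and `U < 1/K` force `U = 0`. -/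
theorem eq_zero_of_le_mul_sq {U K : ℝ} (hK : 0 < K) (hU : 0 ≤ U) (hle : U ≤ K * U ^ 2) (hlt : U < 1 / K) :
    U = 0 := by
  by_contra hne
  have hpos : 0 < U := lt_of_le_of_ne hU (Ne.symm hne)
  have : K * U < 1 := by rwa [lt_div_iff₀ hK, mul_comm] at hlt
  nlinarith

end Summit.Ventures.Crystal3D.Theorems.NearIdentity

end
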